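import Summits.QuantumFields.YangMills.Theorems.BalabanUVNodesN18VertexGraphBrackets
import Summits.QuantumFields.YangMills.Theorems.BalabanUVNodesN18KingModelOneRun

/-!
# BalabanUVNodes ∕ N18 — VERTEX FUNCTIONS: the (g, U)-READING rung of King's model.  King's ACTUAL (4.42) three-factor graphs
# on Bałaban's tori with bounded coupling- and background-dependent insertions at the inner unit-lattice vertices carry (0.25)
# and `NE5` at ONE letter set and, for insertions Lipschitz in the carriers' gauge ∕ in the coupling history, the brackets
# `LipBackground` and `NE9` with NON-ZERO moduli `2ℓ·A`, `2Λ·A` (Track A, DAG node N18 = NE5 `T4OutputRate.NE5 EA EB W κ θ C₅`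
# :211; director-ym R134 row n18 s3 «King-model transfer `N18KingModelTorus` (κ, C₅ from (d, L, a, m², γ)) →
# `TwoRunTorusNE5Final*`», module 6b of seat pub-ymgap-dag-n18-e; 6a = `N18VertexGraphBrackets`)

HONEST FRAMING.  Count-neutral kernel bookkeeping (seat pub-ymgap-dag-n18-e g5, strategy s3; `--supports` K3′
`SpineGivenEndpointR12`, helper).  King's `A = 0` scalar MODEL ([King1986], printed and proved, typed by seats n18-a∕n18-b)
DECORATED with abstract bounded vertex insertions — NOT King's own background dependence (the covariance `C(A)` of the U(1)
Higgs model is non-linear in the gauge field; only the SHAPE of a vertex expansion is modelled), NOT Bałaban's covariant one-step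
outputs `E^{(j)}(X; g, U_k(V))` of [Balaban1987RG1] (0.24)∕(2.13), for which NE5 ∕ NE9 are NOT IN PRINT and have no tree producer
(NODE O instance 0∕1); NOT a node discharge; finite tori; nothing continuum ∕ ℝ⁴ ∕ OS ∕ mass-gap ∕ Clay.  THEOREMS ONLY: 0 `def`,
0 `sorry`, standard axioms.

THE POINT.  Every King-model file of the n18-a∕-e lineage reads functionals that see NEITHER the couplings `g` NOR the
background `U` (p418046's NOT-COVERED «vertex functions at `z, w`»; referee dag-ref-F READ-64 GAP-STATED «no vertex functions»;
5a `kingModel_threeFactor_allShapes_torus`: the `LipBackground` ∕ `NE9` letters ARE zero; the seat's census (i) «U-reading rung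
NOT TYPABLE at A = 0»).  THIS FILE, **`kingModel_vertex_allShapes_torus`**, types the first (g, U)-reading rung on p418046's
binder list: King's ACTUAL outer lines `ℋ = minimiser` and middle line `C^{(·)} = (effLaplacian + aL⁻²·blockProj)⁻¹` with VERTEX
FUNCTIONS `h_X(g, U)(z)`, `k_X(g, U)(w)` bounded by one at the inner unit-lattice vertices — indexed by the domain, reading the
couplings and run A's background; run B reads the SAME insertions through `C.transport` (NE5's «run-B background seen by run A
through the transport») —
`E_A(g, U, X) = Σ_{z,w} ℋ_j(x_A, z)·h_X(g,U)(z)·C^{(j)}(z, w)·k_X(g,U)(w)·ℋ_j(y_A, w)`,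
`E_B(g, U, X) = Σ_{z,w} ℋ_{j+n}(x_B, z)·h_X(g,TU)(z)·C^{(j+n)}(z, w)·k_X(g,TU)(w)·ℋ_{j+n}(y_B, w)`:
`∃ κ > 0, A ≥ 0, C₅ ≥ 0` (functions of `d, L, a, m², γ` ONLY — the SAME letters serve every insertion bounded by one) with
(i) `DecayBound EA W A κ ∧ DecayBound EB W A κ` ((0.25)); (ii) `NE5 EA EB W κ (L^{−γ∕2}) C₅` ((3.73)'s first bound: the insertions
are common to both runs, so only King's lines are differenced); (iii) `LipBackground EA W κ (fun _ _ => 2ℓ·A)` whenever `h, k` are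
`ℓ`-Lipschitz in the carriers' gauge; (iv) `NE9 EA W κ (fun j i => 2Λ_{j,i}·A)` whenever `h, k` are `Λ`-Lipschitz in the coupling
history on the window — [III] (2.27)(ii)'s `C_U` and the cell's NE9 moduli realised as (ONE-RUN ENVELOPE CONSTANT) × (vertex
modulus), scale-free; with `fadingMemory_add_mul` of 6a, fading vertices give `FadingMemory`.  So in this model the U3 three
brackets (`T4OutputRate.u3_threeBrackets`) fire with NO bracket idle.  Composition: 6a's four (g, U)-threaded brackets fed by
n18-b's `minimiser_row_decay` ∕ `minimiser_col_decay` ∕ `minimiser_row_rate` (∘ `N18KingModelTorus.outerRate_le_unif`,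
`blockOf_over`, `tdistT_symm`), `N18KingModelScales.king_cov_decay_torus`, `King1986.king_lemma45_torus`, `tdistT_sumBound`, at
the common rate `κ = ½·min(δ₀ʳᵒʷ, δ₀ᶜᵒˡ, ½δ₀ʳᵃᵗᵉ, δ₄₅)` of p418046.
WHAT THIS DOES NOT DO.  The insertions and their moduli are DATA (no claim that King's or Bałaban's background dependence IS of
this form; the Cauchy step of [III] (2.27)–(2.28) producing `ℓ ∝ 1∕α` is not carried out); (2.20)-rescaling, derivative ∕ Hölder
rows and fine-point smearing (module 5c composes verbatim) not repeated; `A = 0` operators; NOT Bałaban's `E^{(j)}(X; g, U)`.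

Sources: C. King, Commun. Math. Phys. **102** (1986) 649–677 [King1986] — Prop. 3.9 (3.73) p. 665, (4.42)–(4.43) p. 675, Thm 3.3
(3.7) p. 658, (4.33)–(4.34) p. 674, Lemma 4.5 (4.38) p. 674, Prop. 3.8 (3.71) p. 664; T. Bałaban, Commun. Math. Phys. **109** (1987)
249–301 [Balaban1987RG1] — (0.24)–(0.25) p. 257, (1.18) p. 263, §1 p. 263, §5 p. 298; **119** (1988) 243–285 [Balaban1988Convergent]
(2.27)(ii)–(2.28) p. 259.  No claim about the mass gap.
-/

noncomputable section

namespace Summit.QuantumFields.YangMills.BalabanUVNodes.N18KingModelVertices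

open Real Matrix
open Literature.MathematicalPhysics.QuantumFieldTheory.Balaban1983to89 (Params)
open Literature.MathematicalPhysics.QuantumFieldTheory.Balaban1983to89
open Literature.MathematicalPhysics.QuantumFieldTheory.Balaban1983to89.T4OutputRate
  (Carriers Functional NE5 DecayBound NE9 LipBackground)
open Literature.MathematicalPhysics.QuantumFieldTheory.Balaban1983to89.B5Prop11Plancherel (Tor fine)
open Literature.MathematicalPhysics.QuantumFieldTheory.Balaban1983to89.B4Sect5Proof (latticeConst latticeConst_nonneg)
open Literature.MathematicalPhysics.QuantumFieldTheory.King1986 (aK exp_decay_mono prop38RateConst prop38PosConst)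
open Literature.MathematicalPhysics.QuantumFieldTheory.King1986.Torus
  (minimiser effLaplacian blockProj blockOf blockOf_over tdistT tdistT_symm tdistT_nonneg tdistT_isPseudoDist
    tdistT_sumBound gam0L gam0L_pos aminL_le_aK K45 K45_nonneg delta45 delta45_pos king_lemma45_torus
    minimiser_row_decay minimiser_col_decay minimiser_row_rate)
open Summit.QuantumFields.YangMills.BalabanUVNodes.N18KingModel (kingTheta_pos)
open Summit.QuantumFields.YangMills.BalabanUVNodes.N18KingModelScales
  (king_cov_decay_torus inv_pow_le_kingTheta_pow delta45_le_kapCT)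
open Summit.QuantumFields.YangMills.BalabanUVNodes.N18KingModelTorus (outerRate_le_unif)
open Summit.QuantumFields.YangMills.BalabanUVNodes.N18VertexGraphBrackets
  (decayBound_of_vertexGraph ne5_of_vertexGraphRates lipBackground_of_vertexGraph ne9_of_vertexGraph)

variable {d : ℕ}

/-- **KING'S (4.42) GRAPHS WITH VERTEX FUNCTIONS: EVERY `T4OutputRate` §2 SHAPE WITH NON-ZERO LETTERS.**  For `d ≥ 1`, odd
`L > 1`, `a > 0`, `m² > 0`, `0 ≤ γ ≤ 1` there are `κ > 0`, `A ≥ 0`, `C₅ ≥ 0` (functions of `d, L, a, m², γ` only) such that: for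
every `n ≥ 1`; every scale-indexed family of unit tori `L·M_j(μ) = 2L^{m_j}`; every carriers `C` with `1 ≤ scale X` whose
domains read run-A fine points `x_A(X), y_A(X)` UNDER run-B's `x_B(X), y_B(X)` and a tree length `d X ≤ |B(x_A) − B(y_A)|_{T₁}`;
every VERTEX FUNCTIONS `h_X(g, U), k_X(g, U) : T₁ → ℝ` bounded by one (indexed by the domain, reading the couplings and run A's
background); every functionals `E_A(g,U,X) = Σ_{z,w} ℋ_j(x_A,z)h_X(g,U)(z)C^{(j)}(z,w)k_X(g,U)(w)ℋ_j(y_A,w)` and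
`E_B(g,U,X) = Σ_{z,w} ℋ_{j+n}(x_B,z)h_X(g,TU)(z)C^{(j+n)}(z,w)k_X(g,TU)(w)ℋ_{j+n}(y_B,w)` (`T = C.transport`; King's ACTUAL
`ℋ = minimiser`, `C^{(·)} = (effLaplacian + aL⁻²·blockProj)⁻¹`); every window `W`:
(i) `DecayBound EA W A κ ∧ DecayBound EB W A κ`; (ii) `NE5 EA EB W κ (L^{−γ∕2}) C₅`; (iii) for every `ℓ ≥ 0`, if `h, k` are
`ℓ`-Lipschitz in `C.gauge` then `LipBackground EA W κ (fun _ _ => 2ℓ·A)`; (iv) for every non-negative `Λ`, if `h, k` are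
`Λ`-Lipschitz in the coupling history on `W` (`|h_X(g,U) − h_X(g′,U)| ≤ Σ_{i<scale X} Λ(scale X, i)|g_i − g′_i|`) then
`NE9 EA W κ (fun j i => 2Λ_{j,i}·A)`.  6a's brackets on n18-b's outer lines, `king_cov_decay_torus`, `king_lemma45_torus`,
`tdistT_sumBound`; `κ = ½·min(δ₀ʳᵒʷ, δ₀ᶜᵒˡ, ½δ₀ʳᵃᵗᵉ, δ₄₅)`. [cite: King1986, Prop. 3.9 (3.73) p.665, (4.42)–(4.43) p.675, Thm 3.3 p.658, (4.34) p.674, Lemma 4.5 (4.38) p.674, Prop. 3.8 (3.71) p.664; Balaban1987RG1, (0.25) p.257, (1.18) p.263, §5 p.298; Balaban1988Convergent, (2.27) p.259] -/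
theorem kingModel_vertex_allShapes_torus (hd : 1 ≤ d) (L : ℕ) [NeZero L] (hLp : Odd L ∧ 1 < L) {a m2 : ℝ}
    (ha : 0 < a) (hm : 0 < m2) {γ : ℝ} (hγ0 : 0 ≤ γ) (hγ1 : γ ≤ 1) :
    ∃ κ A C₅ : ℝ, 0 < κ ∧ 0 ≤ A ∧ 0 ≤ C₅ ∧
      ∀ (n : ℕ) (_hn : 1 ≤ n) (M : ℕ → Fin d → ℕ) [∀ j μ, NeZero (M j μ)]
        (_hM : ∀ j, ∃ mm : ℕ, ∀ μ, L * M j μ = 2 * L ^ mm)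
        (C : Carriers) (_hsc : ∀ X, 1 ≤ C.scale X)
        (xA yA : (X : C.Dom) → Tor (fine (L ^ C.scale X) (fine L (M (C.scale X)))))
        (xB yB : (X : C.Dom) → Tor (fine (L ^ n * L ^ C.scale X) (fine L (M (C.scale X)))))
        (_hx : ∀ X μ, (xA X μ).val = (xB X μ).val / L ^ n)
        (_hy : ∀ X μ, (yA X μ).val = (yB X μ).val / L ^ n)
        (_hd : ∀ X, C.d X ≤ tdistT (fine L (M (C.scale X)))
            (blockOf (L ^ C.scale X) (fine L (M (C.scale X))) (xA X))
            (blockOf (L ^ C.scale X) (fine L (M (C.scale X))) (yA X)))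
        (h k : (X : C.Dom) → (ℕ → ℝ) → C.BgA → Tor (fine L (M (C.scale X))) → ℝ)
        (_hh : ∀ X g U z, |h X g U z| ≤ 1) (_hk : ∀ X g U w, |k X g U w| ≤ 1)
        (EA : Functional C C.BgA) (EB : Functional C C.BgB)
        (_hEA : ∀ g U X, EA g U X =
          (fun z => minimiser (L ^ C.scale X) (fine L (M (C.scale X))) (aK a L (C.scale X))
              (((L ^ C.scale X : ℕ) : ℝ) ^ 2) m2 (Pi.single z 1) (xA X) * h X g U z)
            ⬝ᵥ ((effLaplacian (L ^ C.scale X) (fine L (M (C.scale X))) (aK a L (C.scale X))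
                    (((L ^ C.scale X : ℕ) : ℝ) ^ 2) m2
                  + (a * ((L : ℝ) ^ 2)⁻¹) • blockProj L (M (C.scale X)))⁻¹
                *ᵥ fun w => k X g U w * minimiser (L ^ C.scale X) (fine L (M (C.scale X))) (aK a L (C.scale X))
                    (((L ^ C.scale X : ℕ) : ℝ) ^ 2) m2 (Pi.single w 1) (yA X)))
        (_hEB : ∀ g U X, EB g U X =
          (fun z => minimiser (L ^ n * L ^ C.scale X) (fine L (M (C.scale X))) (aK a L (C.scale X + n))
              (((L ^ n * L ^ C.scale X : ℕ) : ℝ) ^ 2) m2 (Pi.single z 1) (xB X) * h X g (C.transport U) z)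
            ⬝ᵥ ((effLaplacian (L ^ n * L ^ C.scale X) (fine L (M (C.scale X))) (aK a L (C.scale X + n))
                    (((L ^ n * L ^ C.scale X : ℕ) : ℝ) ^ 2) m2
                  + (a * ((L : ℝ) ^ 2)⁻¹) • blockProj L (M (C.scale X)))⁻¹
                *ᵥ fun w => k X g (C.transport U) w * minimiser (L ^ n * L ^ C.scale X) (fine L (M (C.scale X)))
                    (aK a L (C.scale X + n)) (((L ^ n * L ^ C.scale X : ℕ) : ℝ) ^ 2) m2 (Pi.single w 1) (yB X)))
        (W : Set (ℕ → ℝ)),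
        DecayBound EA W A κ ∧ DecayBound EB W A κ ∧ NE5 EA EB W κ ((L : ℝ) ^ (-(γ / 2))) C₅ ∧
          (∀ ℓ : ℝ, 0 ≤ ℓ →
            (∀ X g (U U' : C.BgA) z, |h X g U z - h X g U' z| ≤ ℓ * C.gauge U U') →
            (∀ X g (U U' : C.BgA) w, |k X g U w - k X g U' w| ≤ ℓ * C.gauge U U') →
              LipBackground EA W κ (fun _ _ => 2 * ℓ * A)) ∧
          (∀ Λ : ℕ → ℕ → ℝ, (∀ j i, 0 ≤ Λ j i) →
            (∀ X, ∀ g ∈ W, ∀ g' ∈ W, ∀ (U : C.BgA) z,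
              |h X g U z - h X g' U z| ≤ ∑ i ∈ Finset.range (C.scale X), Λ (C.scale X) i * |g i - g' i|) →
            (∀ X, ∀ g ∈ W, ∀ g' ∈ W, ∀ (U : C.BgA) w,
              |k X g U w - k X g' U w| ≤ ∑ i ∈ Finset.range (C.scale X), Λ (C.scale X) i * |g i - g' i|) →
              NE9 EA W κ (fun j i => 2 * Λ j i * A)) := by
  have hd0 : 0 < d := hd
  have hL2 : 2 ≤ L := by have := hLp.2; omega
  have hL1 : 1 ≤ L := by omega
  -- the outer-line packages of n18-b (Theorem 3.3 ∕ (3.71) line 1 in block-distance currency), BY NAME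
  obtain ⟨δ₁, c₁, hδ₁, hc₁, H₁⟩ := minimiser_row_decay d L hd hLp ha hm.le
  obtain ⟨δ₂, c₂, hδ₂, hc₂, H₂⟩ := minimiser_col_decay d L hd hLp ha hm.le
  obtain ⟨δ₃, c₃, hδ₃, hc₃, H₃⟩ := minimiser_row_rate d L hd hLp.1 hL2 ha hm hγ0 hγ1
  -- one common decay rate for the outer lines and the middle line (p418046's)
  have hδ45 : 0 < delta45 d a L := delta45_pos (d := d) ha hL2
  set κ : ℝ := min (min (min δ₁ δ₂) (δ₃ / 2)) (delta45 d a L) with hκ_def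
  have hκpos : 0 < κ := lt_min (lt_min (lt_min hδ₁ hδ₂) (half_pos hδ₃)) hδ45
  have hκ₁ : κ ≤ δ₁ := (min_le_left _ _).trans ((min_le_left _ _).trans (min_le_left _ _))
  have hκ₂ : κ ≤ δ₂ := (min_le_left _ _).trans ((min_le_left _ _).trans (min_le_right _ _))
  have hκ₃ : κ ≤ δ₃ / 2 := (min_le_left _ _).trans (min_le_right _ _)
  have hκ45 : κ ≤ delta45 d a L := min_le_right _ _
  have hκ' := hκ45.trans (delta45_le_kapCT (d := d) ha hL2)
  -- the uniform letters
  set Cu : ℝ := prop38RateConst a a (a * (2 * ((a * (1 - ((L : ℝ) ^ 2)⁻¹))⁻¹ + π ^ 2 / 48 + 1 / 3)))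
      ((π ^ 2 / 4) ^ d) d γ + prop38PosConst a ((π ^ 2 / 4) ^ d) d γ with hCu
  set cR : ℝ := Real.sqrt (2 * (a * c₃) * Cu) with hcR
  set θ : ℝ := (L : ℝ) ^ (-(γ / 2)) with hθ_def
  have hθ : 0 ≤ θ := (kingTheta_pos hL1 (γ / 2)).le
  have hcR0 : 0 ≤ cR := Real.sqrt_nonneg _
  have hsA : 0 ≤ a * c₁ := by positivity
  have hsB : 0 ≤ a * c₂ := by positivity
  have hγ₀ : 0 < gam0L d a L := gam0L_pos ha hL2
  have hsC : 0 ≤ 2 / gam0L d a L := by positivity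
  have hK45 : 0 ≤ K45 d a L := K45_nonneg a L
  have hKd : 0 ≤ latticeConst d (κ / 2) := latticeConst_nonneg d (half_pos hκpos).le
  refine ⟨κ / 2, a * c₁ * (2 / gam0L d a L) * (a * c₂) * (latticeConst d (κ / 2)) ^ 2,
    (cR * (2 / gam0L d a L) * (a * c₂) + a * c₁ * K45 d a L * (a * c₂) + a * c₁ * (2 / gam0L d a L) * cR)
      * (latticeConst d (κ / 2)) ^ 2, half_pos hκpos, by positivity, by positivity, ?_⟩
  intro n hn M _ hM C hsc xA yA xB yB hx hy hdd h k hh hk EA EB hEA hEB W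
  -- volume letters of a scale, in n18-b's `Params` currency
  have hPar : ∀ (X : C.Dom) (K : ℕ), ∃ mm : ℕ, ∀ μ, fine L (M (C.scale X)) μ
      = (⟨d, L, mm, K, hd, hLp⟩ : Params).sitesPerDir K := by
    intro X K
    obtain ⟨mm, hmm⟩ := hM (C.scale X)
    exact ⟨mm, fun μ => by simp only [Params.sitesPerDir, Nat.add_sub_cancel]; exact hmm μ⟩
  have hN : ∀ X : C.Dom, L ^ n * L ^ C.scale X = L ^ (C.scale X + n) := fun X => by rw [pow_add, mul_comm]
  -- KING'S LINES.  Outer rows ∕ columns of both runs (Theorem 3.3), their two-run rates ((3.71) line 1), at the rate `κ`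
  have HrA : ∀ (X : C.Dom) z, |minimiser (L ^ C.scale X) (fine L (M (C.scale X))) (aK a L (C.scale X))
        (((L ^ C.scale X : ℕ) : ℝ) ^ 2) m2 (Pi.single z 1) (xA X)|
      ≤ a * c₁ * Real.exp (-(κ * tdistT _ (blockOf (L ^ C.scale X) (fine L (M (C.scale X))) (xA X)) z)) := by
    intro X z
    obtain ⟨mm, hMK⟩ := hPar X (C.scale X)
    exact H₁ ⟨d, L, mm, C.scale X, hd, hLp⟩ rfl rfl (hsc X) (fine L (M (C.scale X))) hMK (L ^ C.scale X) rfl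
      κ hκpos hκ₁ (xA X) z
  have HcA : ∀ (X : C.Dom) w, |minimiser (L ^ C.scale X) (fine L (M (C.scale X))) (aK a L (C.scale X))
        (((L ^ C.scale X : ℕ) : ℝ) ^ 2) m2 (Pi.single w 1) (yA X)|
      ≤ a * c₂ * Real.exp (-(κ * tdistT _ w (blockOf (L ^ C.scale X) (fine L (M (C.scale X))) (yA X)))) := by
    intro X w
    obtain ⟨mm, hMK⟩ := hPar X (C.scale X)
    exact H₂ ⟨d, L, mm, C.scale X, hd, hLp⟩ rfl rfl (hsc X) (fine L (M (C.scale X))) hMK (L ^ C.scale X) rfl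
      κ hκpos hκ₂ (yA X) w
  have HrB : ∀ (X : C.Dom) z, |minimiser (L ^ n * L ^ C.scale X) (fine L (M (C.scale X))) (aK a L (C.scale X + n))
        (((L ^ n * L ^ C.scale X : ℕ) : ℝ) ^ 2) m2 (Pi.single z 1) (xB X)|
      ≤ a * c₁ * Real.exp (-(κ * tdistT _ (blockOf (L ^ C.scale X) (fine L (M (C.scale X))) (xA X)) z)) := by
    intro X z
    obtain ⟨mm, hMK⟩ := hPar X (C.scale X + n)
    have h0 := H₁ ⟨d, L, mm, C.scale X + n, hd, hLp⟩ rfl rfl (show 1 ≤ C.scale X + n by have := hsc X; omega)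
      (fine L (M (C.scale X))) hMK (L ^ n * L ^ C.scale X) (hN X) κ hκpos hκ₁ (xB X) z
    rw [blockOf_over (fine L (M (C.scale X))) (xA X) (xB X) (hx X)] at h0
    exact h0
  have HcB : ∀ (X : C.Dom) w, |minimiser (L ^ n * L ^ C.scale X) (fine L (M (C.scale X))) (aK a L (C.scale X + n))
        (((L ^ n * L ^ C.scale X : ℕ) : ℝ) ^ 2) m2 (Pi.single w 1) (yB X)|
      ≤ a * c₂ * Real.exp (-(κ * tdistT _ w (blockOf (L ^ C.scale X) (fine L (M (C.scale X))) (yA X)))) := by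
    intro X w
    obtain ⟨mm, hMK⟩ := hPar X (C.scale X + n)
    have h0 := H₂ ⟨d, L, mm, C.scale X + n, hd, hLp⟩ rfl rfl (show 1 ≤ C.scale X + n by have := hsc X; omega)
      (fine L (M (C.scale X))) hMK (L ^ n * L ^ C.scale X) (hN X) κ hκpos hκ₂ (yB X) w
    rw [blockOf_over (fine L (M (C.scale X))) (yA X) (yB X) (hy X)] at h0
    exact h0
  have HdR : ∀ (X : C.Dom) z, |minimiser (L ^ n * L ^ C.scale X) (fine L (M (C.scale X))) (aK a L (C.scale X + n))
          (((L ^ n * L ^ C.scale X : ℕ) : ℝ) ^ 2) m2 (Pi.single z 1) (xB X)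
        - minimiser (L ^ C.scale X) (fine L (M (C.scale X))) (aK a L (C.scale X))
          (((L ^ C.scale X : ℕ) : ℝ) ^ 2) m2 (Pi.single z 1) (xA X)|
      ≤ cR * θ ^ C.scale X * Real.exp (-(κ * tdistT _ (blockOf (L ^ C.scale X) (fine L (M (C.scale X))) (xA X)) z)) := by
    intro X z
    obtain ⟨mm, hMK⟩ := hPar X (C.scale X)
    haveI : NeZero (⟨d, L, mm, C.scale X, hd, hLp⟩ : Params).L := ‹NeZero L›
    have h0 := H₃ ⟨d, L, mm, C.scale X, hd, hLp⟩ rfl rfl (hsc X) n hn (fine L (M (C.scale X))) hMK κ hκpos hκ₃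
      (xA X) (xB X) z (hx X)
    exact h0.trans (mul_le_mul_of_nonneg_right (outerRate_le_unif hd0 ha hL2 (hsc X) hn hγ1 hc₃.le)
      (Real.exp_pos _).le)
  have HdC : ∀ (X : C.Dom) w, |minimiser (L ^ n * L ^ C.scale X) (fine L (M (C.scale X))) (aK a L (C.scale X + n))
          (((L ^ n * L ^ C.scale X : ℕ) : ℝ) ^ 2) m2 (Pi.single w 1) (yB X)
        - minimiser (L ^ C.scale X) (fine L (M (C.scale X))) (aK a L (C.scale X))
          (((L ^ C.scale X : ℕ) : ℝ) ^ 2) m2 (Pi.single w 1) (yA X)|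
      ≤ cR * θ ^ C.scale X * Real.exp (-(κ * tdistT _ w (blockOf (L ^ C.scale X) (fine L (M (C.scale X))) (yA X)))) := by
    intro X w
    obtain ⟨mm, hMK⟩ := hPar X (C.scale X)
    haveI : NeZero (⟨d, L, mm, C.scale X, hd, hLp⟩ : Params).L := ‹NeZero L›
    have h0 := H₃ ⟨d, L, mm, C.scale X, hd, hLp⟩ rfl rfl (hsc X) n hn (fine L (M (C.scale X))) hMK κ hκpos hκ₃
      (yA X) (yB X) w (hy X)
    rw [tdistT_symm (fine L (M (C.scale X))) w]
    exact h0.trans (mul_le_mul_of_nonneg_right (outerRate_le_unif hd0 ha hL2 (hsc X) hn hγ1 hc₃.le)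
      (Real.exp_pos _).le)
  -- the middle line: decay BY NAME (`king_cov_decay_torus`) weakened to `κ`, rate BY NAME (Lemma 4.5) with `L^{-j} ≤ θ^j`
  have HCA : ∀ (X : C.Dom) z w, |(effLaplacian (L ^ C.scale X) (fine L (M (C.scale X))) (aK a L (C.scale X))
        (((L ^ C.scale X : ℕ) : ℝ) ^ 2) m2 + (a * ((L : ℝ) ^ 2)⁻¹) • blockProj L (M (C.scale X)))⁻¹ z w|
      ≤ 2 / gam0L d a L * Real.exp (-(κ * tdistT _ z w)) := by
    intro X z w
    obtain ⟨hlo, hhi⟩ := aminL_le_aK ha hL2 (hsc X)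
    exact (king_cov_decay_torus ha hm hL2 (L ^ C.scale X) hlo hhi (M (C.scale X)) z w).trans
      (exp_decay_mono hsC hκ' ((tdistT_isPseudoDist _).nonneg z w))
  have HCB : ∀ (X : C.Dom) z w, |(effLaplacian (L ^ n * L ^ C.scale X) (fine L (M (C.scale X)))
        (aK a L (C.scale X + n)) (((L ^ n * L ^ C.scale X : ℕ) : ℝ) ^ 2) m2
        + (a * ((L : ℝ) ^ 2)⁻¹) • blockProj L (M (C.scale X)))⁻¹ z w|
      ≤ 2 / gam0L d a L * Real.exp (-(κ * tdistT _ z w)) := by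
    intro X z w
    obtain ⟨hlo, hhi⟩ := aminL_le_aK ha hL2 (show 1 ≤ C.scale X + n by have := hsc X; omega)
    exact (king_cov_decay_torus ha hm hL2 (L ^ n * L ^ C.scale X) hlo hhi (M (C.scale X)) z w).trans
      (exp_decay_mono hsC hκ' ((tdistT_isPseudoDist _).nonneg z w))
  have HdM : ∀ (X : C.Dom) z w, |(effLaplacian (L ^ n * L ^ C.scale X) (fine L (M (C.scale X)))
          (aK a L (C.scale X + n)) (((L ^ n * L ^ C.scale X : ℕ) : ℝ) ^ 2) m2
          + (a * ((L : ℝ) ^ 2)⁻¹) • blockProj L (M (C.scale X)))⁻¹ z w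
        - (effLaplacian (L ^ C.scale X) (fine L (M (C.scale X))) (aK a L (C.scale X))
          (((L ^ C.scale X : ℕ) : ℝ) ^ 2) m2 + (a * ((L : ℝ) ^ 2)⁻¹) • blockProj L (M (C.scale X)))⁻¹ z w|
      ≤ K45 d a L * θ ^ C.scale X * Real.exp (-(κ * tdistT _ z w)) := by
    intro X z w
    have h45 := king_lemma45_torus ha hm hL2 (hsc X) hn (M (C.scale X)) z w
    rw [abs_sub_comm]
    refine h45.trans ?_
    have ht : 0 ≤ tdistT _ z w := (tdistT_isPseudoDist _).nonneg z w
    calc K45 d a L * ((L : ℝ) ^ C.scale X)⁻¹ * Real.exp (-(delta45 d a L * tdistT _ z w))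
        ≤ K45 d a L * θ ^ C.scale X * Real.exp (-(delta45 d a L * tdistT _ z w)) :=
          mul_le_mul_of_nonneg_right (mul_le_mul_of_nonneg_left (inv_pow_le_kingTheta_pow hL1 (by linarith) _) hK45)
            (Real.exp_pos _).le
      _ ≤ K45 d a L * θ ^ C.scale X * Real.exp (-(κ * tdistT _ z w)) :=
          exp_decay_mono (mul_nonneg hK45 (pow_nonneg hθ _)) hκ45 ht
  -- the lattice sums BY NAME (uniform in the torus)
  have hV : ∀ (j : ℕ) (s : Tor (fine L (M j))),
      ∑ z, Real.exp (-(κ / 2 * tdistT (fine L (M j)) s (id z))) ≤ latticeConst d (κ / 2) :=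
    fun j s => tdistT_sumBound (fine L (M j)) (κ / 2) (half_pos hκpos) s
  -- VERTEX FUNCTIONS.  Rows `ℋ·h`, columns `k·ℋ`: envelopes (|h|, |k| ≤ 1), two-run rates (common insertions), Lipschitz moduli
  have hmul1 : ∀ {x y B : ℝ}, |x| ≤ B → |y| ≤ 1 → |x * y| ≤ B := fun hx hy => by
    rw [abs_mul]; exact (mul_le_of_le_one_right (abs_nonneg _) hy).trans hx
  have hmul2 : ∀ {x y B : ℝ}, |x| ≤ 1 → |y| ≤ B → |x * y| ≤ B := fun hx hy => by
    rw [abs_mul]; exact (mul_le_of_le_one_left (abs_nonneg _) hx).trans hy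
  have hmul3 : ∀ {x y B m : ℝ}, |x| ≤ B → |y| ≤ m → |x * y| ≤ m * B := by
    intro x y B m hx hy
    rw [abs_mul, mul_comm m]
    exact mul_le_mul hx hy (abs_nonneg _) ((abs_nonneg _).trans hx)
  refine ⟨?_, ?_, ?_, ?_, ?_⟩
  · -- (i) run A
    exact decayBound_of_vertexGraph (C := C) (β := fun j => Tor (fine L (M j))) (P := fun j => Tor (fine L (M j)))
      (fun j => tdistT (fine L (M j))) (fun j => (tdistT_isPseudoDist _).nonneg)
      (fun j => (tdistT_isPseudoDist _).triangle) (fun _ => id)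
      (fun X => blockOf (L ^ C.scale X) (fine L (M (C.scale X))) (xA X))
      (fun X => blockOf (L ^ C.scale X) (fine L (M (C.scale X))) (yA X))
      (fun g U X z => minimiser (L ^ C.scale X) (fine L (M (C.scale X))) (aK a L (C.scale X))
        (((L ^ C.scale X : ℕ) : ℝ) ^ 2) m2 (Pi.single z 1) (xA X) * h X g U z)
      (fun g U X w => k X g U w * minimiser (L ^ C.scale X) (fine L (M (C.scale X))) (aK a L (C.scale X))
        (((L ^ C.scale X : ℕ) : ℝ) ^ 2) m2 (Pi.single w 1) (yA X))
      (fun X => (effLaplacian (L ^ C.scale X) (fine L (M (C.scale X))) (aK a L (C.scale X))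
          (((L ^ C.scale X : ℕ) : ℝ) ^ 2) m2 + (a * ((L : ℝ) ^ 2)⁻¹) • blockProj L (M (C.scale X)))⁻¹)
      hκpos.le hsA hsC hsB (fun g U X z => hmul1 (HrA X z) (hh X g U z)) HCA
      (fun g U X w => hmul2 (hk X g U w) (HcA X w)) hV hdd EA hEA W
  · -- (i) run B
    exact decayBound_of_vertexGraph (C := C) (β := fun j => Tor (fine L (M j))) (P := fun j => Tor (fine L (M j)))
      (fun j => tdistT (fine L (M j))) (fun j => (tdistT_isPseudoDist _).nonneg)
      (fun j => (tdistT_isPseudoDist _).triangle) (fun _ => id)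
      (fun X => blockOf (L ^ C.scale X) (fine L (M (C.scale X))) (xA X))
      (fun X => blockOf (L ^ C.scale X) (fine L (M (C.scale X))) (yA X))
      (fun g U X z => minimiser (L ^ n * L ^ C.scale X) (fine L (M (C.scale X))) (aK a L (C.scale X + n))
        (((L ^ n * L ^ C.scale X : ℕ) : ℝ) ^ 2) m2 (Pi.single z 1) (xB X) * h X g (C.transport U) z)
      (fun g U X w => k X g (C.transport U) w * minimiser (L ^ n * L ^ C.scale X) (fine L (M (C.scale X)))
        (aK a L (C.scale X + n)) (((L ^ n * L ^ C.scale X : ℕ) : ℝ) ^ 2) m2 (Pi.single w 1) (yB X))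
      (fun X => (effLaplacian (L ^ n * L ^ C.scale X) (fine L (M (C.scale X))) (aK a L (C.scale X + n))
          (((L ^ n * L ^ C.scale X : ℕ) : ℝ) ^ 2) m2 + (a * ((L : ℝ) ^ 2)⁻¹) • blockProj L (M (C.scale X)))⁻¹)
      hκpos.le hsA hsC hsB (fun g U X z => hmul1 (HrB X z) (hh X g _ z)) HCB
      (fun g U X w => hmul2 (hk X g _ w) (HcB X w)) hV hdd EB hEB W
  · -- (ii) NE5: only King's lines are differenced (the insertions are common to both runs)
    exact ne5_of_vertexGraphRates (C := C) (β := fun j => Tor (fine L (M j))) (P := fun j => Tor (fine L (M j)))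
      (fun j => tdistT (fine L (M j))) (fun j => (tdistT_isPseudoDist _).nonneg)
      (fun j => (tdistT_isPseudoDist _).triangle) (fun _ => id)
      (fun X => blockOf (L ^ C.scale X) (fine L (M (C.scale X))) (xA X))
      (fun X => blockOf (L ^ C.scale X) (fine L (M (C.scale X))) (yA X))
      (fun g U X z => minimiser (L ^ C.scale X) (fine L (M (C.scale X))) (aK a L (C.scale X))
        (((L ^ C.scale X : ℕ) : ℝ) ^ 2) m2 (Pi.single z 1) (xA X) * h X g U z)
      (fun g U X w => k X g U w * minimiser (L ^ C.scale X) (fine L (M (C.scale X))) (aK a L (C.scale X))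
        (((L ^ C.scale X : ℕ) : ℝ) ^ 2) m2 (Pi.single w 1) (yA X))
      (fun g U X z => minimiser (L ^ n * L ^ C.scale X) (fine L (M (C.scale X))) (aK a L (C.scale X + n))
        (((L ^ n * L ^ C.scale X : ℕ) : ℝ) ^ 2) m2 (Pi.single z 1) (xB X) * h X g (C.transport U) z)
      (fun g U X w => k X g (C.transport U) w * minimiser (L ^ n * L ^ C.scale X) (fine L (M (C.scale X)))
        (aK a L (C.scale X + n)) (((L ^ n * L ^ C.scale X : ℕ) : ℝ) ^ 2) m2 (Pi.single w 1) (yB X))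
      (fun X => (effLaplacian (L ^ C.scale X) (fine L (M (C.scale X))) (aK a L (C.scale X))
          (((L ^ C.scale X : ℕ) : ℝ) ^ 2) m2 + (a * ((L : ℝ) ^ 2)⁻¹) • blockProj L (M (C.scale X)))⁻¹)
      (fun X => (effLaplacian (L ^ n * L ^ C.scale X) (fine L (M (C.scale X))) (aK a L (C.scale X + n))
          (((L ^ n * L ^ C.scale X : ℕ) : ℝ) ^ 2) m2 + (a * ((L : ℝ) ^ 2)⁻¹) • blockProj L (M (C.scale X)))⁻¹)
      hκpos.le hθ hsA hsC hsB hcR0 hK45 hcR0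
      (fun g U X z => hmul1 (HrA X z) (hh X g _ z)) HCA HCB (fun g U X w => hmul2 (hk X g _ w) (HcB X w))
      (fun g U X z => by rw [← sub_mul]; exact hmul1 (HdR X z) (hh X g _ z)) HdM
      (fun g U X w => by rw [← mul_sub]; exact hmul2 (hk X g _ w) (HdC X w)) hV hdd hEA hEB W
  · -- (iii) the background-Lipschitz bracket from `ℓ`-Lipschitz vertices
    intro ℓ hℓ hhℓ hkℓ
    have hB := lipBackground_of_vertexGraph (C := C) (β := fun j => Tor (fine L (M j)))
      (P := fun j => Tor (fine L (M j)))
      (fun j => tdistT (fine L (M j))) (fun j => (tdistT_isPseudoDist _).nonneg)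
      (fun j => (tdistT_isPseudoDist _).triangle) (fun _ => id)
      (fun X => blockOf (L ^ C.scale X) (fine L (M (C.scale X))) (xA X))
      (fun X => blockOf (L ^ C.scale X) (fine L (M (C.scale X))) (yA X))
      (fun g U X z => minimiser (L ^ C.scale X) (fine L (M (C.scale X))) (aK a L (C.scale X))
        (((L ^ C.scale X : ℕ) : ℝ) ^ 2) m2 (Pi.single z 1) (xA X) * h X g U z)
      (fun g U X w => k X g U w * minimiser (L ^ C.scale X) (fine L (M (C.scale X))) (aK a L (C.scale X))
        (((L ^ C.scale X : ℕ) : ℝ) ^ 2) m2 (Pi.single w 1) (yA X))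
      (fun X => (effLaplacian (L ^ C.scale X) (fine L (M (C.scale X))) (aK a L (C.scale X))
          (((L ^ C.scale X : ℕ) : ℝ) ^ 2) m2 + (a * ((L : ℝ) ^ 2)⁻¹) • blockProj L (M (C.scale X)))⁻¹)
      (ℓu := ℓ) (ℓv := ℓ) hκpos.le hsA hsC hsB hℓ hℓ
      (fun g U X z => hmul1 (HrA X z) (hh X g U z)) HCA (fun g U X w => hmul2 (hk X g U w) (HcA X w))
      (fun g U U' X z => by
        rw [← mul_sub]
        calc _ ≤ (ℓ * C.gauge U U') * (a * c₁ * Real.exp (-(κ * tdistT _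
              (blockOf (L ^ C.scale X) (fine L (M (C.scale X))) (xA X)) (id z)))) :=
              hmul3 (HrA X z) (hhℓ X g U U' z)
          _ = _ := by ring)
      (fun g U U' X w => by
        rw [← sub_mul]
        calc _ ≤ (ℓ * C.gauge U U') * (a * c₂ * Real.exp (-(κ * tdistT _ (id w)
              (blockOf (L ^ C.scale X) (fine L (M (C.scale X))) (yA X))))) := by
              rw [mul_comm (k X g U w - k X g U' w)]
              exact hmul3 (HcA X w) (hkℓ X g U U' w)
          _ = _ := by ring)
      hV hdd EA hEA W
    rw [two_mul]
    exact hB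
  · -- (iv) the history bracket from `Λ`-Lipschitz vertices
    intro Λ hΛ hhΛ hkΛ
    have hB := ne9_of_vertexGraph (C := C) (β := fun j => Tor (fine L (M j))) (P := fun j => Tor (fine L (M j)))
      (fun j => tdistT (fine L (M j))) (fun j => (tdistT_isPseudoDist _).nonneg)
      (fun j => (tdistT_isPseudoDist _).triangle) (fun _ => id)
      (fun X => blockOf (L ^ C.scale X) (fine L (M (C.scale X))) (xA X))
      (fun X => blockOf (L ^ C.scale X) (fine L (M (C.scale X))) (yA X))
      (fun g U X z => minimiser (L ^ C.scale X) (fine L (M (C.scale X))) (aK a L (C.scale X))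
        (((L ^ C.scale X : ℕ) : ℝ) ^ 2) m2 (Pi.single z 1) (xA X) * h X g U z)
      (fun g U X w => k X g U w * minimiser (L ^ C.scale X) (fine L (M (C.scale X))) (aK a L (C.scale X))
        (((L ^ C.scale X : ℕ) : ℝ) ^ 2) m2 (Pi.single w 1) (yA X))
      (fun X => (effLaplacian (L ^ C.scale X) (fine L (M (C.scale X))) (aK a L (C.scale X))
          (((L ^ C.scale X : ℕ) : ℝ) ^ 2) m2 + (a * ((L : ℝ) ^ 2)⁻¹) • blockProj L (M (C.scale X)))⁻¹)
      (Λu := Λ) (Λv := Λ) (W := W) hκpos.le hsA hsC hsB hΛ hΛ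
      (fun g U X z => hmul1 (HrA X z) (hh X g U z)) HCA (fun g U X w => hmul2 (hk X g U w) (HcA X w))
      (fun g hg g' hg' U X z => by
        rw [← mul_sub]
        calc _ ≤ (∑ i ∈ Finset.range (C.scale X), Λ (C.scale X) i * |g i - g' i|) * (a * c₁ * Real.exp (-(κ *
              tdistT _ (blockOf (L ^ C.scale X) (fine L (M (C.scale X))) (xA X)) (id z)))) :=
              hmul3 (HrA X z) (hhΛ X g hg g' hg' U z)
          _ = _ := by ring)
      (fun g hg g' hg' U X w => by
        rw [← sub_mul]
        calc _ ≤ (∑ i ∈ Finset.range (C.scale X), Λ (C.scale X) i * |g i - g' i|) * (a * c₂ * Real.exp (-(κ *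
              tdistT _ (id w) (blockOf (L ^ C.scale X) (fine L (M (C.scale X))) (yA X))))) := by
              rw [mul_comm (k X g U w - k X g' U w)]
              exact hmul3 (HcA X w) (hkΛ X g hg g' hg' U w)
          _ = _ := by ring)
      hV hdd EA hEA
    have e : (fun j i => 2 * Λ j i * (a * c₁ * (2 / gam0L d a L) * (a * c₂) * latticeConst d (κ / 2) ^ 2))
        = fun j i => (Λ j i + Λ j i) * (a * c₁ * (2 / gam0L d a L) * (a * c₂) * latticeConst d (κ / 2) ^ 2) := by
      funext j i; ring
    rw [e]
    exact hB

end Summit.QuantumFields.YangMills.BalabanUVNodes.N18KingModelVertices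

end
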